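import Summits.QuantumFields.YangMills.Theorems.BalabanUVNodesN21AtKeyedRateHomeU2

/-!
# YM-DAG node N21 (= NE7c) AT A KEYED RATE HOME, THE K-UNIFORM CASE (ONE NE3 layer for every run length — layer A's «constant family»): THE END's side
# letters are CHOSEN, not displayed — the energy letter `γ_E`, the cube root `l₁`, the `Λ₂′`-bound and the family base `θ_F` are produced inside the proof —,
# so NE7c's `ShellWeightBound` at explicit carriers follows, WITH SOME GEOMETRIC WEIGHT, from N16's record decl `N16At` + n16-e's displayed proviso
# `InEndRegime` at that layer, the regularity numeral, `0 < Λ₂′`, the level ledgers ∕ windows ∕ `D ≤ D̄`, the [dict] clauses, and the threshold widths (node U2)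

Track A of `YM-PLAN.md` (cell `pub-ymgap`, HUMAN RULING D-0062), node **N21**; R134 fan-out seat `pub-ymgap-dag-n21-d` (s2 = BY-NAME KNIT), generation 2, module 8 —
companion of modules 5 ∕ 6 (`BalabanUVNodesN21AtKeyedRateHome` p463475, `…U2` p464795), which display THE END's side letters `γ_E, l₁, Λ̄, θ` as hypotheses uniform
in the run length.  At a CONSTANT layer `o : Node00.NE3Objects₁₁ N` (RR-1's `RateObjects₁₁.ne3` docstring: «a constant family is the K-uniform case») uniformity is
free and the letters can be CHOSEN (`γ_E³ ≥ max(1, ·)`, `l₁³ ≥ max(1, Λ₁)`, `Λ̄ = Λ₂′`, `θ_F` = `exists_familyBase`).  THEOREMS ONLY: 0 `def`, 0 `sorry`, standard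
axioms; COUNT-NEUTRAL; `--supports` the K3 item (`SpineGivenEndpointR11` stmt-QuantumFields-19676 → K3′ once born).  Stage-free; restate-immune (no Theses import).

WHAT IS PROVED ([folklore] real bookkeeping + module 5 ∕ 6 BY NAME).
* §1 `exists_energyLetter` (for any reals `x`: some `γ_E > 0` with `x ≤ γ_E³`), `exists_cubeRootLetter` (some `l₁ > 0` with `Λ₁ ≤ l₁³`).
* §2 `shellWeightBound_geometric_of_constLayer` — at a constant NE3 layer `o` with N16's record decl `h16 : N16At (ne3OfRecord₁₁ F o)`, the sign letters
  `1 ≤ o.Nper`, `0 ≤ o.b`, `0 ≤ o.g`, `0 ≤ o.C`, the regularity numeral `512·5·8·(F.L)²·o.b ≤ 1`, `0 < o.Λ₂′`, a threshold unit `ε′ > 0`, a flux letter `cg ≥ 0`,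
  explicit carriers with the two LEVEL LEDGERS ([dict] + (M1)), LIVE WINDOWS (N20), `D ≤ D̄` (N12), threshold widths `τ ≤ c₂ϑ₂^j` (`0 ≤ ϑ₂ < 1`) and the two [dict]
  clauses (module 5's, at the constant layer): `∃ ϑ C, 0 < ϑ < 1 ∧ 0 ≤ C ∧ ShellWeightBound l₀ T A B shA shB (K ↦ C·ϑ^K)` — NE7c at explicit carriers with SOME
  geometric weight; THE END's `γ_E, l₁, Λ̄, θ_F` chosen inside.
* §3 `shellWeightBound_geometric_of_constLayer_inEndRegime` — the same with the four sign letters DISCHARGED from n16-e's displayed proviso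
  `InEndRegime (ne3OfRecord₁₁ F o)` (module 5's `signs_of_inEndRegime_ne3OfRecord₁₁`): what a pin in THE END's regime carrying `N16At` owes N21 on road I is the
  regularity numeral, `0 < Λ₂′`, and the term object's ledgers ∕ [dict].
* §4 `shellWeightBound_geometric_of_constLayer_u2Output` — §3 with the threshold widths BY NAME from node U2 (module 6's `thresholdRate_left ∕ _right_of_u2Output`:
  `U2Output D g₀ Cout θ₂`, tuned window, smallness, [dict-thr] clauses).

HONEST FRAMING (binding).  `N16At`, `InEndRegime`, `U2Output`, the ledgers ((M1) NOT PRINTED + [dict]), live windows, `D ≤ D̄`, threshold widths and the [dict] ∕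
[dict-thr] clauses are HYPOTHESES, displayed; the constant-layer case is ONE pin convention (RR-1), not a claim about Bałaban's objects; readings residual (NODE O);
nothing of Bałaban's asserted; NE7c NOT PRINTED and NOT PROVED; **N21 NOT discharged**; typed 28∕28, discharged count untouched; one finite four-torus programme at
fixed `ε` — NOT ℝ⁴, NOT infinite volume, NOT OS, NOT a mass gap, NOT Clay.  No decl below carries a cite tag.
-/

set_option autoImplicit false

noncomputable section

open scoped BigOperators Matrix Matrix.Norms.L2Operator

namespace Summit.QuantumFields.YangMills.Theorems.N21AtKeyedRateHomeConst

open Literature.MathematicalPhysics.QuantumFieldTheory.Balaban1983to89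
open Literature.MathematicalPhysics.QuantumFieldTheory.Balaban1983to89.T4Continuum (T4Family ULoop FiniteEpsData)
open B7Prop1Explicit B7Prop2Explicit
open T4AveragingDeficitWall (Plane)
open T4IndicatorShell (ShellWeightBound)
open T4ShellMeasureLevels (LevelLedger LiveWindow)
open Summit.QuantumFields.BalabanUV.T4Continuum
open Summit.QuantumFields.BalabanUV.T4Continuum.Spine.NE4 (U2Output runFlow)
open MinimalActionSandwich (IsMinimiser)
open MinimalActionRate (Regular sfClass)
open MinimalActionRefine (RegularSup)
open AveragingDeficitDualResidual (dualC1 dualC2)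
open AveragingDeficitDerivWallProof (wallConst)
open YMDAG.UVSplit (N16At ne3OfRecord₁₁)
open Summit.QuantumFields.YangMills.BalabanUVNodes.N16Regime (InEndRegime)
open N21AtKeyedRateHome (exists_familyBase signs_of_inEndRegime_ne3OfRecord₁₁ shellWeightBound_geometric_of_ne3Layers)
open N21AtKeyedRateHomeU2 (cout_nonneg_of_u2Output thresholdRate_left_of_u2Output thresholdRate_right_of_u2Output)
open Node00 (NE3Objects₁₁ Stage7Numerics epsOfRecord)

variable {N : ℕ} [NeZero N]

/-! ## §1 Choosing THE END's energy letter and cube root -/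

/-- **THE ENERGY LETTER CAN BE CHOSEN**: for every real `x` there is `γ_E > 0` with `x ≤ γ_E³` (`γ_E = max 1 x`). [folklore] -/
theorem exists_energyLetter (x : ℝ) : ∃ γE : ℝ, 0 < γE ∧ x ≤ γE ^ 3 := by
  refine ⟨max 1 x, lt_of_lt_of_le one_pos (le_max_left _ _), ?_⟩
  have h1 : 1 ≤ max 1 x := le_max_left _ _
  calc x ≤ max 1 x := le_max_right _ _
    _ = max 1 x * 1 * 1 := by ring
    _ ≤ max 1 x * max 1 x * max 1 x := by gcongr
    _ = max 1 x ^ 3 := by ring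

/-- **THE CUBE ROOT CAN BE CHOSEN**: for every real `Λ₁` there is `l₁ > 0` with `Λ₁ ≤ l₁³`. [folklore] -/
theorem exists_cubeRootLetter (Λ₁ : ℝ) : ∃ l₁ : ℝ, 0 < l₁ ∧ Λ₁ ≤ l₁ ^ 3 :=
  exists_energyLetter Λ₁

/-! ## §2 NE7c at explicit carriers at a CONSTANT NE3 layer: THE END's letters chosen -/

section ConstLayer

variable {F : T4Family} {o : NE3Objects₁₁ N} (h16 : N16At (ne3OfRecord₁₁ F o))
  (hbs : 512 * (4 + 1) * (4 + 4) * (F.L : ℝ) ^ 2 * o.b ≤ 1) (hΛ₂' : 0 < o.Λ₂') {ε' cg : ℝ} (hε' : 0 < ε') (hcg : 0 ≤ cg)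
  {ι σA σB : Type*} {l₀ : ℝ} {T : ℕ → Finset ι} {A B shA shB : ℕ → ℝ → ι → ℝ}
  {SA : ℕ → Finset σA} {SB : ℕ → Finset σB} {pieceA : ℕ → ℝ → σA → ι → ℝ} {pieceB : ℕ → ℝ → σB → ι → ℝ}
  {lvlA : ℕ → σA → ℕ} {lvlB : ℕ → σB → ℕ} {DA ρA DB ρB τA τB : ℕ → ℝ} {N₁ : ℕ} {νbar Dbar : ℝ}
  (hLA : LevelLedger l₀ T A shA SA pieceA lvlA DA ρA) (hLB : LevelLedger l₀ T B shB SB pieceB lvlB DB ρB)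
  (hwA : LiveWindow SA lvlA N₁ νbar) (hwB : LiveWindow SB lvlB N₁ νbar) (hDA : ∀ j, DA j ≤ Dbar) (hDB : ∀ j, DB j ≤ Dbar)
  (hdictA : ∀ j, 1 ≤ j → ∀ x : ℝ,
    (∀ (V UA UB : B7Prop1Explicit.Site 4 → Fin 4 → (Matrix (Fin N) (Fin N) ℂ)ˣ) (z : B7Prop1Explicit.Site 4) (μ ν : Fin 4) (t : ℝ),
      V ∈ o.dom → IsMinimiser 4 (sfClass 4 F.L o.Nper o.ε) F.L o.Nper j V UA → IsMinimiser 4 (sfClass 4 F.L o.Nper o.ε) F.L o.Nper (j + 1) V UB →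
      Regular 4 F.L o.Nper o.b o.g (j + 1) UB → ε' * ((F.L : ℝ)⁻¹) ^ (2 * j) ≤ t →
      |‖((hol UA z (plaqWord μ ν) : (Matrix (Fin N) (Fin N) ℂ)ˣ) : Matrix (Fin N) (Fin N) ℂ) - 1‖
          - ‖((hol (rescale F.L (bavg F.L UB)) z (plaqWord μ ν) : (Matrix (Fin N) (Fin N) ℂ)ˣ) : Matrix (Fin N) (Fin N) ℂ) - 1‖| / t ≤ x) →
    ρA j ≤ x + τA j)
  (hdictB : ∀ j, 1 ≤ j → ∀ x : ℝ,
    (∀ (V UA UB : B7Prop1Explicit.Site 4 → Fin 4 → (Matrix (Fin N) (Fin N) ℂ)ˣ) (z : B7Prop1Explicit.Site 4) (π : Plane 4)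
      (r₀ : Fin 4 → Fin F.L) (i₀ j₀ : ℕ) (t : ℝ),
      V ∈ o.dom → IsMinimiser 4 (sfClass 4 F.L o.Nper o.ε) F.L o.Nper j V UA → IsMinimiser 4 (sfClass 4 F.L o.Nper o.ε) F.L o.Nper (j + 1) V UB →
      Regular 4 F.L o.Nper o.b o.g (j + 1) UB → RegularSup 4 F.L o.Nper o.b cg (j + 1) UB → i₀ < F.L → j₀ < F.L →
      ε' * ((F.L : ℝ)⁻¹) ^ (2 * j) ≤ t →
      |‖((hol UA z (plaqWord π.1.1 π.1.2) : (Matrix (Fin N) (Fin N) ℂ)ˣ) : Matrix (Fin N) (Fin N) ℂ) - 1‖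
          - (F.L : ℝ) ^ 2 * ‖((hol UB ((F.L : ℤ) • z + boxVec F.L r₀ + (i₀ : ℤ) • e π.1.1 + (j₀ : ℤ) • e π.1.2)
              (plaqWord π.1.1 π.1.2) : (Matrix (Fin N) (Fin N) ℂ)ˣ) : Matrix (Fin N) (Fin N) ℂ) - 1‖| / t ≤ x) →
    ρB j ≤ x + τB j)

include h16 hbs hΛ₂' hε' hcg hLA hLB hwA hwB hDA hDB hdictA hdictB

/-- **NE7c AT EXPLICIT CARRIERS AT A CONSTANT NE3 LAYER — THE END's LETTERS CHOSEN.**  HYPOTHESES: N16's record decl `h16 : N16At (ne3OfRecord₁₁ F o)` at the home's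
NE3 bundle of ONE object `o` read at every run length (the K-uniform case); the sign letters `1 ≤ o.Nper`, `0 ≤ o.b`, `0 ≤ o.g`, `0 ≤ o.C`; the regularity numeral;
`0 < o.Λ₂′`; `ε′ > 0`, `cg ≥ 0`; explicit carriers `(l₀, T, A, B, shA, shB)` with the two LEVEL LEDGERS, LIVE WINDOWS, `D ≤ D̄`; threshold widths `τA, τB ≤ c₂ϑ₂^j`
(`0 ≤ c₂`, `0 ≤ ϑ₂ < 1`); the two [dict] clauses at the layer.  CONCLUSION: `∃ ϑ C, 0 < ϑ < 1 ∧ 0 ≤ C ∧ ShellWeightBound l₀ T A B shA shB (K ↦ C·ϑ^K)` — module 5's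
`shellWeightBound_geometric_of_ne3Layers` at the constant family, with `θ_F` (`exists_familyBase`), `γ_E` (`exists_energyLetter`), `l₁` (`exists_cubeRootLetter`) and
`Λ̄ := o.Λ₂′` CHOSEN; `ϑ = θ_F ∨ ϑ₂`.  CONDITIONAL on every displayed binder; NE7c NOT proved; N21 NOT discharged. [folklore] -/
theorem shellWeightBound_geometric_of_constLayer (hN : 1 ≤ o.Nper) (hb : 0 ≤ o.b) (hg : 0 ≤ o.g) (hC : 0 ≤ o.C)
    {c₂ ϑ₂ : ℝ} (hc₂ : 0 ≤ c₂) (h₂ : 0 ≤ ϑ₂) (h₂' : ϑ₂ < 1) (hτA : ∀ j, τA j ≤ c₂ * ϑ₂ ^ j) (hτB : ∀ j, τB j ≤ c₂ * ϑ₂ ^ j) :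
    ∃ ϑ C : ℝ, 0 < ϑ ∧ ϑ < 1 ∧ 0 ≤ C ∧ ShellWeightBound l₀ T A B shA shB fun K => C * ϑ ^ K := by
  obtain ⟨θ, hθ, hθ1, hθ6⟩ := exists_familyBase F
  obtain ⟨γE, hγE, hγ3⟩ := exists_energyLetter
    (o.C * (wallConst 4 F.L * (o.Nper : ℝ) ^ 2 * (Real.sqrt o.g * dualC2 4 F.L + 2 * o.b ^ 2 * dualC1 4 F.L)))
  obtain ⟨l₁, hl₁, hΛl₁⟩ := exists_cubeRootLetter o.Λ₁
  obtain ⟨C, hC0, hSW⟩ := shellWeightBound_geometric_of_ne3Layers (o := fun _ => o) (fun _ => h16) hθ hθ1 hθ6 (fun _ => hN) (fun _ => hb)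
    (fun _ => hbs) (fun _ => hg) (fun _ => hC) (fun _ => hΛ₂') (fun _ => le_rfl) hγE (fun _ => hγ3) hl₁ (fun _ => hΛl₁) hε' hcg hLA hLB hwA hwB
    hDA hDB hc₂ h₂ h₂' hτA hτB
    (fun j hj x hx => hdictA j hj x fun V UA UB z μ ν t hV hA hB hreg ht => hx 0 V UA UB z μ ν t hV hA hB hreg ht)
    (fun j hj x hx => hdictB j hj x fun V UA UB z π r₀ i₀ j₀ t hV hA hB hreg hsup hi₀ hj₀ ht =>
      hx 0 V UA UB z π r₀ i₀ j₀ t hV hA hB hreg hsup hi₀ hj₀ ht)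
  exact ⟨max θ ϑ₂, C, lt_max_of_lt_left hθ, max_lt hθ1 h₂', hC0, hSW⟩

/-! ## §3 The sign letters from the displayed proviso `InEndRegime` -/

/-- **THE SAME, SIGNS FROM THE PROVISO**: with n16-e's displayed proviso `InEndRegime (ne3OfRecord₁₁ F o)` the four sign letters are discharged
(`signs_of_inEndRegime_ne3OfRecord₁₁`); a pin in THE END's regime carrying `N16At` owes N21's road I only the regularity numeral, `0 < Λ₂′`, the ledgers and [dict].
[folklore] -/
theorem shellWeightBound_geometric_of_constLayer_inEndRegime (hreg : InEndRegime (ne3OfRecord₁₁ F o))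
    {c₂ ϑ₂ : ℝ} (hc₂ : 0 ≤ c₂) (h₂ : 0 ≤ ϑ₂) (h₂' : ϑ₂ < 1) (hτA : ∀ j, τA j ≤ c₂ * ϑ₂ ^ j) (hτB : ∀ j, τB j ≤ c₂ * ϑ₂ ^ j) :
    ∃ ϑ C : ℝ, 0 < ϑ ∧ ϑ < 1 ∧ 0 ≤ C ∧ ShellWeightBound l₀ T A B shA shB fun K => C * ϑ ^ K := by
  obtain ⟨hN, hb, hg, hC⟩ := signs_of_inEndRegime_ne3OfRecord₁₁ F o hreg
  exact shellWeightBound_geometric_of_constLayer h16 hbs hΛ₂' hε' hcg hLA hLB hwA hwB hDA hDB hdictA hdictB hN hb hg hC hc₂ h₂ h₂' hτA hτB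

/-! ## §4 … and the threshold widths BY NAME from node U2 -/

/-- **THE SAME, THRESHOLD WIDTHS FROM NODE U2**: `InEndRegime` + `N16At` at the constant layer, the regularity numeral, `0 < Λ₂′`, and node U2's
`U2Output D g₀ Cout θ₂` (`0 ≤ θ₂ < 1`) with the couplings of every tuned run in `(0, γ]`, `γ < 1`, numerics `0 ≤ ν.A₀`, the smallness `(1 + p₀∕log γ⁻²)γ²Cout ≤ 1∕2`
and the two [dict-thr] clauses (module 6) ⇒ `∃ ϑ C, 0 < ϑ < 1 ∧ 0 ≤ C ∧ ShellWeightBound l₀ T A B shA shB (K ↦ C·ϑ^K)`. [folklore] -/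
theorem shellWeightBound_geometric_of_constLayer_u2Output (hreg : InEndRegime (ne3OfRecord₁₁ F o))
    {G : Type*} [GaugeGroup G] [MeasurableSpace G] [HaarData G]
    (ν : Stage7Numerics) (hA₀ : 0 ≤ ν.A₀) (D : FiniteEpsData F G) (g₀ : ℕ → ℝ) {Cout θ₂ γ : ℝ} (hU2 : U2Output D g₀ Cout θ₂)
    (h₂ : 0 ≤ θ₂) (h₂' : θ₂ < 1) (hγ1 : γ < 1) (hwin : ∀ K i, i ≤ K → 0 < runFlow D g₀ K i ∧ runFlow D g₀ K i ≤ γ)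
    (hsmall : (1 + ν.p₀ / Real.log (γ ^ 2)⁻¹) * γ ^ 2 * Cout ≤ 1 / 2)
    (hthrA : ∀ j, ∀ x : ℝ, (∀ K, j ≤ K →
      |epsOfRecord ν (runFlow D g₀ K) j - epsOfRecord ν (runFlow D g₀ (K + 1)) (j + 1)| ≤ x * epsOfRecord ν (runFlow D g₀ K) j) → τA j ≤ x)
    (hthrB : ∀ j, ∀ x : ℝ, (∀ K, j ≤ K →
      |epsOfRecord ν (runFlow D g₀ K) j - epsOfRecord ν (runFlow D g₀ (K + 1)) (j + 1)| ≤ x * epsOfRecord ν (runFlow D g₀ (K + 1)) (j + 1)) →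
      τB j ≤ x) :
    ∃ ϑ C : ℝ, 0 < ϑ ∧ ϑ < 1 ∧ 0 ≤ C ∧ ShellWeightBound l₀ T A B shA shB fun K => C * ϑ ^ K := by
  have hγ : 0 < γ := lt_of_lt_of_le (hwin 0 0 le_rfl).1 (hwin 0 0 le_rfl).2
  have hlogγ : 0 < Real.log (γ ^ 2)⁻¹ := Real.log_pos ((one_lt_inv₀ (by positivity)).mpr (by nlinarith))
  have hCout : 0 ≤ Cout := cout_nonneg_of_u2Output D g₀ hU2
  have hc₂ : 0 ≤ 2 * ((1 + ν.p₀ / Real.log (γ ^ 2)⁻¹) * γ ^ 2 * Cout) := by positivity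
  exact shellWeightBound_geometric_of_constLayer_inEndRegime h16 hbs hΛ₂' hε' hcg hLA hLB hwA hwB hDA hDB hdictA hdictB hreg hc₂ h₂ h₂'
    (thresholdRate_left_of_u2Output ν hA₀ D g₀ hU2 h₂ h₂'.le hγ1 hwin hsmall hthrA)
    (thresholdRate_right_of_u2Output ν hA₀ D g₀ hU2 h₂ h₂'.le hγ1 hwin hsmall hthrB)

end ConstLayer

end Summit.QuantumFields.YangMills.Theorems.N21AtKeyedRateHomeConst

end
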